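import Summits.ResolutionOfSingularities.ResolutionOfSingularities.Theorems.FrobeniusClosingSteerCleanedOrderMonotone
import Summits.ResolutionOfSingularities.ResolutionOfSingularities.Theorems.FrobeniusClosingSteerDivisorTriggerTwoChart
import HarnessLib

/-!
# Crux `Steer` (stmt-ResolutionOfSingularities-16345), chain W4.1: **the near-point order bound at a POINT STEP of a steered run**
# (run-level re-keying of `CleanedOrderMonotone.exists_div_pow_not_mem_pow_succ` — the order engine of the hARᵒ slot S1 / D·S3 bookkeeping)

OURS (campaign `res-hironaka`, rung L ★L-G4, slot W4.1; seat res-type-096 g9; res-type-062 hAR-BLUEPRINT v1 b05763b89178e0bc §2 S1 «+ the order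
bookkeeping ν»; replaces the role of no printed item; NOT a statement of the manuscript under review [claim: Hironaka2017, status: under-review];
AI-produced, weaker than expert review). Theses-free and definition-free.

* `div_pow_not_mem_pow_succ_of_pointStep` — along a point step of the run (`IsLocalBlowupAlong O R (maximalIdeal R) R'`, `R` regular local
  dominated by `O`, exceptional parameter `x` of maximal value on `𝔪_R`, i.e. `IsExcParamAlong O R 𝔪 x` unfolded), an element `h ∈ 𝔪^ν ∖ 𝔪^(ν+1)`
  has weak transform `h / x^ν ∈ R'` of order `≤ ν`: `∃ w : R', w · x^ν = h ∧ w ∉ 𝔪_{R'}^(ν+1)` (Cossart–Piltant 2008 (11)/(a) in the run currency;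
  `R' = (R[𝔪/x])_{𝔪_O ∩ R[𝔪/x]}` by res-D-pv-011's `DivisorTrigger.eq_locAtCentre_blowupRing`).
* `not_mem_pow_of_mul_pow_eq_of_pointStep` — contrapositive packaging: if `w · x^ν = h` with `w ∈ R'` and `h ∉ 𝔪^(ν+1)`, `h ∈ 𝔪^ν`, then
  `w ∉ 𝔪_{R'}^(ν+1)` (the weak transform is determined by `h` and `x`).

[cite: CossartPiltant2008, proof of Prop. 4.2, (11) and (a)] [folklore]
-/

noncomputable section

-- `Summit.<S>.<S>.…` duplicates the summit name by design (single-problem summit).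
set_option linter.dupNamespace false

open IsLocalRing

namespace Summit.ResolutionOfSingularities.ResolutionOfSingularities.Theorems.SwitchingDichotomy

open Literature.AlgebraicGeometry.Resolution

namespace PointStepOrderBound

variable {K : Type} [Field K]

/-- **Near-point order bound at a point step of the run.** OURS. [cite: CossartPiltant2008, proof of Prop. 4.2, (11) and (a)] -/
theorem div_pow_not_mem_pow_succ_of_pointStep {O : ValuationSubring K} {R R' : Subring K}
    [IsRegularLocalRing R] [IsLocalRing R'] (hRO : SubringDominates R O.toSubring)
    (hbl : IsLocalBlowupAlong O R (maximalIdeal R) R')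
    {x : K} (hxR : x ∈ R) (hxm : (⟨x, hxR⟩ : R) ∈ maximalIdeal R) (hx0 : x ≠ 0)
    (hxmax : ∀ y : R, y ∈ maximalIdeal R → O.valuation (y : K) ≤ O.valuation x)
    {h : R} {ν : ℕ} (hν : h ∈ maximalIdeal R ^ ν) (hν' : h ∉ maximalIdeal R ^ (ν + 1)) :
    ∃ w : R', (w : K) * x ^ ν = (h : K) ∧ w ∉ maximalIdeal R' ^ (ν + 1) := by
  have hR' : R' = locAtCentre (blowupRing R x) O := DivisorTrigger.eq_locAtCentre_blowupRing hbl hxR hxm hx0 hxmax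
  have hx0' : (⟨x, hxR⟩ : R) ≠ 0 := fun e => hx0 (congrArg Subtype.val e)
  exact CleanedOrderMonotone.exists_div_pow_not_mem_pow_succ hRO hxm hx0' hxmax hR' hν hν'

/-- **The weak transform is determined by `h` and `x`**: any `w ∈ R'` with `w · x^ν = h` (`h` of `𝔪_R`-order exactly `ν`) satisfies
`w ∉ 𝔪_{R'}^(ν+1)`. OURS. [folklore] -/
theorem not_mem_pow_of_mul_pow_eq_of_pointStep {O : ValuationSubring K} {R R' : Subring K}
    [IsRegularLocalRing R] [IsLocalRing R'] (hRO : SubringDominates R O.toSubring)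
    (hbl : IsLocalBlowupAlong O R (maximalIdeal R) R')
    {x : K} (hxR : x ∈ R) (hxm : (⟨x, hxR⟩ : R) ∈ maximalIdeal R) (hx0 : x ≠ 0)
    (hxmax : ∀ y : R, y ∈ maximalIdeal R → O.valuation (y : K) ≤ O.valuation x)
    {h : R} {ν : ℕ} (hν : h ∈ maximalIdeal R ^ ν) (hν' : h ∉ maximalIdeal R ^ (ν + 1))
    (w : R') (hw : (w : K) * x ^ ν = (h : K)) : w ∉ maximalIdeal R' ^ (ν + 1) := by
  obtain ⟨w', hw', hw'n⟩ := div_pow_not_mem_pow_succ_of_pointStep hRO hbl hxR hxm hx0 hxmax hν hν'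
  have heq : w = w' := by
    apply Subtype.ext
    have hxν : x ^ ν ≠ 0 := pow_ne_zero ν hx0
    exact mul_right_cancel₀ hxν (hw.trans hw'.symm)
  rw [heq]
  exact hw'n

end PointStepOrderBound

end Summit.ResolutionOfSingularities.ResolutionOfSingularities.Theorems.SwitchingDichotomy

end
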